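import Summits.Parity.BatemanHorn.Cruxes.RoughValueLaw.SketchIdeator3

/-!
# Crux-triage r1-3, card `omega-class-shape-split`: its first lemma `SemiprimeShape` (I) already implies
# the route's OTHER crux `BalancedSemiprimeLayer` for the system `![f]`

Machine-checked form of TRIAGE-r1-3 Appendix A.  For a quadratic `f`, the card's tilt-invariant stub
`Ideator3.SemiprimeShape f` together with its own bookkeeping stub `Ideator3.RoughDecomposition f`
(provable now, per the card) and the classical upper-bound sieve at depth `u = 3`
(`Φ_f(x, x^{2/3}) ≪ x / log x`, hypothesis `hUB`) gives `LayerConclusion f`, i.e. VERBATIM the conclusion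
of `BalancedSemiprimeLayer` (crux stmt-Parity-9469, rank 3, XL) for the system `![f]`
(`layerConclusion_of_balancedSemiprimeLayer` certifies the reading by `fun h hf => h 1 ![f] hf`).  So the "attackable half" (I) is at least as hard as the
sibling crux; modulo `RoughValueLaw` it is Bateman–Horn for `f` (TRIAGE-r1-3 Appendix A, second half;
cf. `Theorems/BalancedSemiprimeLayer/Negative/RelativeConsistency.lean`).
-/

namespace Summit.Parity.BatemanHorn.Cruxes.RoughValueLaw.Triage3

open Filter Finset Polynomial
open scoped Topology Classical
open Literature.NumberTheory.Sieve
open Summit.Parity.BatemanHorn.Cruxes.RoughValueLaw.Ideator3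
  (roughCount semiprimeCell SemiprimeShape RoughDecomposition)
open Summit.Parity.BatemanHorn.Theses.RoughValueTransport (BalancedSemiprimeLayer)

/-- The left-hand count of `BalancedSemiprimeLayer` for one system (verbatim the route file's finset). -/
noncomputable def layerCount {k : ℕ} (f : Fin k → ℤ[X]) (δ : ℝ) (x : ℕ) : ℕ :=
  ((Icc 1 x).filter (fun n : ℕ => ∀ i, 0 < (f i).eval (n : ℤ) ∧
    ∀ p ∈ range ⌈(x : ℝ) ^ (((f i).natDegree : ℝ) * (1 - δ) / 2)⌉₊,
      p.Prime → ¬ ((p : ℤ) ∣ (f i).eval (n : ℤ)))).card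

/-- The conclusion of `BalancedSemiprimeLayer` for the single-polynomial system `![f]` (k = 1). -/
def LayerConclusion (f : ℤ[X]) : Prop :=
  ∀ ε : ℝ, 0 < ε → ∃ δ : ℝ, 0 < δ ∧ δ ≤ 1 / 4 ∧ ∀ᶠ x : ℕ in atTop,
    (layerCount ![f] δ x : ℝ) ≤ (polyPrimeCount ![f] x : ℝ) + ε * (x : ℝ) / Real.log x ^ 1

/-- Sanity: `LayerConclusion f` IS what the sibling crux asserts for the system `![f]`. -/
theorem layerConclusion_of_balancedSemiprimeLayer (h : BalancedSemiprimeLayer) (f : ℤ[X])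
    (hf : IsBatemanHornSystem ![f]) : LayerConclusion f :=
  fun ε hε => h 1 ![f] hf ε hε

/-- Bridge: for `natDegree f = 2` the layer count of the system `![f]` at parameter `δ` is the card's
`roughCount f x (1 - δ)` (sifting level `x^{2(1-δ)/2} = x^{1-δ}`). -/
theorem layerCount_eq (f : ℤ[X]) (hdeg : f.natDegree = 2) (δ : ℝ) (x : ℕ) :
    layerCount ![f] δ x = roughCount f x (1 - δ) := by
  unfold layerCount roughCount
  congr 1
  refine filter_congr fun n _ => ?_
  have h2 : ((2 : ℕ) : ℝ) * (1 - δ) / 2 = 1 - δ := by push_cast; ring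
  simp only [Fin.forall_fin_one, Matrix.cons_val_fin_one, hdeg, h2]

/-- Balanced semiprime values at depth `3` are `x^{2/3}`-rough values. -/
theorem semiprimeCell_three_le_roughCount (f : ℤ[X]) (x : ℕ) :
    semiprimeCell f x 3 ≤ roughCount f x (2 / 3) := by
  unfold semiprimeCell roughCount
  apply card_le_card
  intro n hn
  rw [mem_filter] at hn ⊢
  obtain ⟨hn, p, q, hp, hq, hxp, hpq, hf⟩ := hn
  refine ⟨hn, ?_, fun r hr hrp hdvd => ?_⟩
  · rw [hf]; exact_mod_cast Nat.mul_pos hp.pos hq.pos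
  · rw [hf] at hdvd
    have hdvd' : r ∣ p * q := by exact_mod_cast hdvd
    have hr' : r < ⌈(x : ℝ) ^ ((2 : ℝ) / 3)⌉₊ := mem_range.mp hr
    -- r ∈ {p, q}, hence r ≥ p ≥ x^{2/3}, contradicting r < ⌈x^{2/3}⌉₊
    have hrge : p ≤ r := by
      rcases (Nat.Prime.dvd_mul hrp).mp hdvd' with h | h
      · exact ((Nat.prime_dvd_prime_iff_eq hrp hp).mp h).symm.le
      · exact hpq.trans ((Nat.prime_dvd_prime_iff_eq hrp hq).mp h).symm.le
    have hxr : (x : ℝ) ^ ((2 : ℝ) / 3) ≤ r := hxp.trans (by exact_mod_cast hrge)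
    exact absurd (Nat.ceil_le.mpr hxr) (not_le.mpr hr')

/-- `log((1+δ)/(1-δ)) ≤ 4δ` for `0 ≤ δ ≤ 1/2`. -/
theorem log_ratio_le_four_mul {δ : ℝ} (hδ0 : 0 ≤ δ) (hδ : δ ≤ 1 / 2) :
    Real.log ((1 + δ) / (1 - δ)) ≤ 4 * δ := by
  have h1 : 0 < 1 - δ := by linarith
  have hpos : 0 < (1 + δ) / (1 - δ) := div_pos (by linarith) h1
  calc Real.log ((1 + δ) / (1 - δ)) ≤ (1 + δ) / (1 - δ) - 1 := Real.log_le_sub_one_of_pos hpos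
    _ = 2 * δ / (1 - δ) := by field_simp; ring
    _ ≤ 4 * δ := by
        rw [div_le_iff₀ h1]; nlinarith

/-- **Appendix A, machine-checked.** `SemiprimeShape f` (the card's first lemma, "intra-parity, tilt-
invariant") together with the card's bookkeeping stub `RoughDecomposition f` and an upper-bound sieve at
depth `3` implies the conclusion of the sibling crux `BalancedSemiprimeLayer` for the system `![f]`. -/
theorem layerConclusion_of_semiprimeShape (f : ℤ[X]) (hdeg : f.natDegree = 2)
    (hI : SemiprimeShape f) (hRD : RoughDecomposition f)
    (hUB : ∃ C : ℝ, ∀ᶠ x : ℕ in atTop, (roughCount f x (2 / 3) : ℝ) * Real.log x / x ≤ C) :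
    LayerConclusion f := by
  obtain ⟨B, hB⟩ := hI
  obtain ⟨C, hC⟩ := hUB
  intro ε hε
  -- constants
  set K : ℝ := (max C 0 + 1) / Real.log 2 with hK
  have hlog2 : 0 < Real.log 2 := Real.log_pos (by norm_num)
  have hK0 : 0 < K := div_pos (by positivity) hlog2
  set δ : ℝ := min (1 / 4) (ε / (16 * K)) with hδdef
  have hδ0 : 0 < δ := lt_min (by norm_num) (div_pos hε (by positivity))
  have hδ4 : δ ≤ 1 / 4 := min_le_left _ _
  have hδK : δ ≤ ε / (16 * K) := min_le_right _ _
  refine ⟨δ, hδ0, hδ4, ?_⟩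
  -- the depth u = 2/(1-δ) ∈ (2, 3]
  set u : ℝ := 2 / (1 - δ) with hu
  have h1δ : 0 < 1 - δ := by linarith
  have hu2 : 2 < u := by
    rw [hu, lt_div_iff₀ h1δ]; linarith
  have hu3 : u ≤ 3 := by
    rw [hu, div_le_iff₀ h1δ]; linarith
  have h2u : 2 / u = 1 - δ := by
    rw [hu]; field_simp
  have hu1 : u - 1 = (1 + δ) / (1 - δ) := by
    rw [hu]; field_simp; ring
  have hℓ0 : 0 ≤ Real.log (u - 1) := Real.log_nonneg (by linarith)
  have hℓ : Real.log (u - 1) ≤ 4 * δ := by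
    rw [hu1]; exact log_ratio_le_four_mul hδ0.le (by linarith)
  have hKℓ : K * Real.log (u - 1) ≤ ε / 4 := by
    calc K * Real.log (u - 1) ≤ K * (4 * δ) := mul_le_mul_of_nonneg_left hℓ hK0.le
      _ ≤ K * (4 * (ε / (16 * K))) := by gcongr
      _ = ε / 4 := by field_simp; ring
  -- the three limit statements, as eventual one-sided bounds
  have hA1 := (hB 3 (by norm_num) le_rfl).eventually_const_lt (show (-1 : ℝ) < 0 by norm_num)
  have hA2 := (hB u hu2 hu3).eventually_lt_const (show (0 : ℝ) < ε / 4 by positivity)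
  have hA3 := (hRD u hu2 hu3).eventually_lt_const (show (0 : ℝ) < ε / 4 by positivity)
  rw [h2u] at hA3
  filter_upwards [hA1, hA2, hA3, hC, eventually_ge_atTop 2] with x h1 h2 h3 h4 hx
  rw [layerCount_eq f hdeg δ x, pow_one]
  -- positivity of the weight t = log x / x
  have hx0 : (0 : ℝ) < x := by exact_mod_cast (show 0 < x by omega)
  have hL : 0 < Real.log x := Real.log_pos (by exact_mod_cast (show 1 < x by omega))
  set t : ℝ := Real.log x / x with ht
  have ht0 : 0 < t := div_pos hL hx0
  -- S3 ≤ R3 (subset)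
  have h5nat : (semiprimeCell f x 3 : ℝ) ≤ (roughCount f x (2 / 3) : ℝ) := by
    exact_mod_cast semiprimeCell_three_le_roughCount f x
  -- names for the counts
  set S3 : ℝ := (semiprimeCell f x 3 : ℝ)
  set Sδ : ℝ := (semiprimeCell f x u : ℝ)
  set R3 : ℝ := (roughCount f x (2 / 3) : ℝ)
  set R : ℝ := (roughCount f x (1 - δ) : ℝ)
  set P : ℝ := (polyPrimeCount ![f] x : ℝ)
  -- rewrite the hypotheses in terms of t
  have e1 : (S3 - B x * Real.log (3 - 1)) * Real.log x / x = S3 * t - Real.log 2 * (B x * t) := by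
    rw [ht]; norm_num; ring
  have e2 : (Sδ - B x * Real.log (u - 1)) * Real.log x / x = Sδ * t - Real.log (u - 1) * (B x * t) := by
    rw [ht]; ring
  have e3 : (R - P - Sδ) * Real.log x / x = R * t - P * t - Sδ * t := by
    rw [ht]; ring
  have e4 : R3 * Real.log x / x = R3 * t := by rw [ht]; ring
  rw [e1] at h1
  rw [e2] at h2
  rw [e3] at h3
  rw [e4] at h4
  -- S3 ≤ R3 (subset), hence B·t < K
  have h5 : S3 * t ≤ R3 * t := mul_le_mul_of_nonneg_right h5nat ht0.le
  have hC' : R3 * t ≤ max C 0 := h4.trans (le_max_left _ _)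
  have hBt : B x * t ≤ K := by
    have : Real.log 2 * (B x * t) ≤ max C 0 + 1 := by linarith
    rw [hK, le_div_iff₀ hlog2]; linarith
  -- Sδ t ≤ K log(u-1) + ε/4 ≤ ε/2
  have hSδ : Sδ * t ≤ ε / 2 := by
    have h6 : Real.log (u - 1) * (B x * t) ≤ Real.log (u - 1) * K :=
      mul_le_mul_of_nonneg_left hBt hℓ0
    have h7 : Real.log (u - 1) * K = K * Real.log (u - 1) := mul_comm _ _
    linarith
  -- (R - P) t < 3ε/4, un-normalise
  have hRP : (R - P) * t ≤ 3 * ε / 4 := by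
    have h8 : (R - P) * t = R * t - P * t := by ring
    linarith
  have hRP' : R - P ≤ 3 * ε / 4 * (x / Real.log x) := by
    have := (le_div_iff₀ ht0).mpr hRP
    calc R - P ≤ 3 * ε / 4 / t := this
      _ = 3 * ε / 4 * (x / Real.log x) := by rw [ht]; field_simp
  have hxL : 0 ≤ (x : ℝ) / Real.log x := div_nonneg hx0.le hL.le
  calc R ≤ P + 3 * ε / 4 * (x / Real.log x) := by linarith
    _ ≤ P + ε * x / Real.log x := by
        have : 3 * ε / 4 * (x / Real.log x) ≤ ε * (x / Real.log x) :=
          mul_le_mul_of_nonneg_right (by linarith) hxL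
        calc P + 3 * ε / 4 * (x / Real.log x) ≤ P + ε * (x / Real.log x) := by linarith
          _ = P + ε * x / Real.log x := by ring

end Summit.Parity.BatemanHorn.Cruxes.RoughValueLaw.Triage3
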